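import Summits.ResolutionOfSingularities.ResolutionOfSingularities.Theorems.PurelyInseparableDim4ResConeCInfLayerPrime
import Summits.ResolutionOfSingularities.ResolutionOfSingularities.Theorems.PurelyInseparableDim4ResConeCInfLegalityPrime
import Summits.ResolutionOfSingularities.ResolutionOfSingularities.Theorems.PurelyInseparableDim4SwapTransportWindowWeightsSigma
import Summits.ResolutionOfSingularities.ResolutionOfSingularities.Theorems.PurelyInseparableDim4SwapTransportReadOne
import HarnessLib
import HarnessLib.Audit.Tags

/-!
# Purely inseparable four-folds — A TRANSLATED TWIN-SLOT CHILD IN REGIME IS STRAIGHT, EVERY σ = (n, n) + 0 AND EVERY PRIME: `e_G = 3` plus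
# the σ-ledger force the residual cone to be `a·x_f^d` (cell `res-dim4-pi`, K2(p) lane, class (iii) rows σ = (n, n) + 0, flagless branch;
# the `1 ↦ n` edition of `…ResConeCInfTranslatedStraightPrime` p725651; seat res-dim4-typ-1 g6)

[OURS · counted 0 · cell `res-dim4-pi` · K2(p) lane (holder res-dim4-p-12 g5, e = 3 MAP: «class (iii) (2,2)+0 / (3,3)+0 flagless ⇒ regime R ⇒
`not_isIsolated_of_regimeR_of_le_five`», res-dim4-p-3 g6 l.7164: «modulo the σ-edition of LC/LAYER for weights (n,n) — typ-1's 1 ↦ n substitution»).]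
Nothing here proves K2(p) for any `p`, any TAIL(p, d, 3), FLAGLESS♯, `NoIsolatedTrap p p` or resolution of singularities in dimension ≥ 4 /
characteristic `p` — NOT proved.  AI kernel work, weaker than expert review.  Reading lemmas about OUR frame; they kill nothing by themselves.

SETTING: twin slots `j, i` of weight `n ≥ 1`, free letter `u`, contact letter `f`; `n + d = p`; a twin-slot state has `r = n·j + n·i`, order
`p + n`, residual degree `d`; σ-LEDGER «`e_f ≤ d − 1 ⇒ e_j, e_i ≥ n + 1`».
* §1 **`straight_of_finrank_three_of_ledger_sigma`** — `e_G = 3` + σ-ledger ⇒ `resForm = a·x_f^d`, `a ≠ 0` (the residual cone `c·ℓ^d` of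
  `resForm_eq_C_mul_pow_of_finrank_eq_three` has no `x_k x_f^{d−1}`, `x_k^d` for `k ≠ f` by the ledger ⇒ `ℓ ∝ x_f`, `linearForm_off_eq_zero_pow`).
* §2 **`ledger_step_translate_u_sigma`** — the σ-ledger passes to a translated slot child `step p univ j (update 0 u β) s` (ANY `β`) of a
  support-straight twin-slot state of order `p + n` (res-dim4-p-3's weight-free backward law `exists_parent_of_mem_support_step_translate_u`).
* §3 **`translated_child_frame_sigma`** — such a child, if of order `p + n` with `e_G = 3`, has the same weights, `x^r ∣`, the σ-ledger,
  `resForm = a′·x_f^d` and the support dress «degree `p + n` ⇒ the cone `x_j^n x_i^n x_f^d`».  The `i`-slot edition is the statement with `j ↔ i`.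
[cite: CossartJannsenSaito2020, Thm. 3.14] [cite: Hauser2010, §§F–G]
bears_on: LADDER-RESOLUTION:D157-DOOR2 (res-dim4-pi · K2(p) · class (iii) σ = (n,n)+0 flagless branch: translated children are straight).
Supports stmt-ResolutionOfSingularities-16155 (helper).
-/

set_option linter.dupNamespace false -- mandated namespace of this single-conjunct summit

noncomputable section

namespace Summit.ResolutionOfSingularities.ResolutionOfSingularities.Theorems.PIDim4

namespace ResCone

open MvPolynomial Finset
open Literature.AlgebraicGeometry.Resolution
open Literature.AlgebraicGeometry.Resolution.CentreBlowup
open Literature.AlgebraicGeometry.Resolution.Hauser2010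
open Literature.AlgebraicGeometry.Resolution.HauserPerlega2019

variable {K : Type} [Field K]

/-- The twin cone exponent does not see the order of the two slot letters. [OURS · bookkeeping] -/
theorem cone_comm_sigma (j i u f : Fin 4) (n d : ℕ) :
    (Finsupp.single i n + Finsupp.single j n + Finsupp.single u 0 + Finsupp.single f d : Fin 4 →₀ ℕ) =
      Finsupp.single j n + Finsupp.single i n + Finsupp.single u 0 + Finsupp.single f d := by
  rw [add_comm (Finsupp.single i n) (Finsupp.single j n)]

section Letters

variable {j i u f : Fin 4} (hji : j ≠ i) (hju : j ≠ u) (hjf : j ≠ f) (hiu : i ≠ u) (hif : i ≠ f) (huf : u ≠ f)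
include hji hju hjf hiu hif huf

/-! ## 1. `e_G = 3` and the σ-ledger make the residual cone `a·x_f^d` -/

omit hju hiu huf in
/-- **`e_G = 3` + σ-LEDGER ⇒ STRAIGHT**: a twin-slot state (`r = n·j + n·i`, `x^r ∣ F`, order `p + n`, `n + d = p`, `1 ≤ d`) with
polar-kernel rank `3` and the σ-ledger has `resForm = a·x_f^d`, `a ≠ 0`. [OURS] [cite: CossartJannsenSaito2020, Thm. 3.14] -/
theorem straight_of_finrank_three_of_ledger_sigma (p : ℕ) [Fact p.Prime] [CharP K p] {n d : ℕ} (hσ : n + d = p) (hn : 0 < n)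
    (hd1 : 1 ≤ d)
    {s : State K} (hr : s.r = Finsupp.single j n + Finsupp.single i n) (hdiv : ∀ e ∈ s.F.support, s.r ≤ e)
    (ho : ordZero s.F = ((p + n : ℕ) : ℕ∞)) (he3 : Module.finrank K (resVertex s) = 3)
    (hled : ∀ e ∈ s.F.support, e f ≤ d - 1 → n + 1 ≤ e j ∧ n + 1 ≤ e i) :
    ∃ a : K, a ≠ 0 ∧ resForm s = C a * X f ^ d := by
  classical
  have hp : p.Prime := Fact.out
  have hdK : (d : K) ≠ 0 := fun h => by
    have hdvd := (CharP.cast_eq_zero_iff K p d).mp h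
    have := Nat.le_of_dvd (by omega) hdvd
    omega
  have hrj : s.r j = n := by rw [hr]; simp [hji]
  have hri : s.r i = n := by rw [hr]; simp [hji.symm]
  have hrf : s.r f = 0 := by rw [hr]; simp [hjf.symm, hif.symm]
  have hrdeg : s.r.degree = 2 * n := by rw [hr, map_add, Finsupp.degree_single, Finsupp.degree_single]; ring
  obtain ⟨ℓ, c, hℓ0, -, hform⟩ := resForm_eq_C_mul_pow_of_finrank_eq_three p ho (by rw [hrdeg]; omega) he3
  rw [hrdeg, show p + n - 2 * n = d by omega] at hform
  have hread : ∀ m : Fin 4 →₀ ℕ, m.degree = d → coeff m (C c * (∑ i, C (ℓ i) * X i) ^ d) = coeff (s.r + m) s.F := by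
    intro m hm
    rw [← hform, coeff_resForm, NarrowApolarity.coeff_initialForm_of_degree_eq ho (by rw [map_add, hrdeg, hm]; omega)]
  have hdead : ∀ m : Fin 4 →₀ ℕ, m.degree = d → m f ≤ d - 1 → (m j = 0 ∨ m i = 0) →
      coeff m (C c * (∑ i, C (ℓ i) * X i) ^ d) = 0 := by
    intro m hm hmf hor
    rw [hread m hm]
    by_contra hne
    have h := hled _ (mem_support_iff.mpr hne) (by rw [Finsupp.add_apply, hrf, zero_add]; exact hmf)
    rw [Finsupp.add_apply, Finsupp.add_apply, hrj, hri] at h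
    omega
  have hc : coeff (Finsupp.single f d) (C c * (∑ i, C (ℓ i) * X i) ^ d) ≠ 0 := by
    intro h0
    rw [coeff_C_mul, coeff_single_linearFormSum_pow] at h0
    rcases mul_eq_zero.mp h0 with hc0 | hℓf
    · exact resForm_ne_zero ho hdiv (by rw [hform, hc0, C_0, zero_mul])
    · have hℓf0 : ℓ f = 0 := pow_eq_zero_iff (by omega) |>.mp hℓf
      apply hℓ0
      funext k
      by_cases hkf : k = f
      · rw [hkf, hℓf0]; rfl
      · have hk := hdead (Finsupp.single k d) (Finsupp.degree_single _ _)
          (by rw [Finsupp.single_eq_of_ne (fun h => hkf h.symm)]; exact Nat.zero_le _) (by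
            by_cases hkj : k = j
            · right; rw [hkj, Finsupp.single_eq_of_ne hji.symm]
            · left; rw [Finsupp.single_eq_of_ne (Ne.symm hkj)])
        rw [coeff_C_mul, coeff_single_linearFormSum_pow] at hk
        rcases mul_eq_zero.mp hk with hc0 | hℓk
        · exact absurd (by rw [hform, hc0, C_0, zero_mul]) (resForm_ne_zero ho hdiv)
        · exact pow_eq_zero_iff (by omega) |>.mp hℓk
  have h0 : ∀ k, k ≠ f → coeff (Finsupp.single k 1 + Finsupp.single f (d - 1)) (C c * (∑ i, C (ℓ i) * X i) ^ d) = 0 := by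
    intro k hkf
    refine hdead _ (by rw [map_add, Finsupp.degree_single, Finsupp.degree_single]; omega)
      (by rw [Finsupp.add_apply, Finsupp.single_eq_of_ne (fun h => hkf h.symm), Finsupp.single_eq_same, zero_add]) ?_
    by_cases hkj : k = j
    · right
      rw [hkj, Finsupp.add_apply, Finsupp.single_eq_of_ne hji.symm, Finsupp.single_eq_of_ne hif, add_zero]
    · left
      rw [Finsupp.add_apply, Finsupp.single_eq_of_ne (Ne.symm hkj), Finsupp.single_eq_of_ne hjf, add_zero]
  have hoff := linearForm_off_eq_zero_pow f hdK hc h0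
  have hL : (∑ i, C (ℓ i) * X i : MvPolynomial (Fin 4) K) = C (ℓ f) * X f := by
    rw [← Finset.add_sum_erase _ _ (Finset.mem_univ f)]
    rw [Finset.sum_eq_zero fun k hk => by rw [hoff k (Finset.ne_of_mem_erase hk), C_0, zero_mul], add_zero]
  refine ⟨c * ℓ f ^ d, ?_, ?_⟩
  · intro h0
    apply hc
    rw [coeff_C_mul, coeff_single_linearFormSum_pow, h0]
  · rw [hform, hL, mul_pow, ← map_pow, ← mul_assoc, ← map_mul]

/-! ## 2. The σ-ledger passes to a translated slot child -/

/-- **σ-LEDGER OF A TRANSLATED SLOT CHILD, any `β`**: from a support-straight twin-slot state of order `p + n` (`n + d = p`) with the σ-ledger,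
every monomial of `step p univ j (update 0 u β) s` with `e_f ≤ d − 1` has `e_j, e_i ≥ n + 1` (res-dim4-p-3's backward law: a parent on the
line has the same `i`- and `f`-exponents, degree `e_j + p`, and degree `p + n` only at the cone). [OURS] [cite: Hauser2010, §§F–G] -/
theorem ledger_step_translate_u_sigma (p : ℕ) {n d : ℕ} (hσ : n + d = p) [DecidableEq K] (s : State K)
    (hq : ((p : ℕ) : ℕ∞) ≤ ordAlong Finset.univ s.F) (h6 : ∀ e ∈ s.F.support, p + n ≤ e.degree)
    (hstraight : ∀ e ∈ s.F.support, e.degree = p + n →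
      e = Finsupp.single j n + Finsupp.single i n + Finsupp.single u 0 + Finsupp.single f d)
    (hled : ∀ e ∈ s.F.support, e f ≤ d - 1 → n + 1 ≤ e j ∧ n + 1 ≤ e i) (hd1 : 1 ≤ d) (β : K) :
    ∀ E ∈ (CentreBlowup.step p Finset.univ j (Function.update (0 : Fin 4 → K) u β) s).F.support,
      E f ≤ d - 1 → n + 1 ≤ E j ∧ n + 1 ≤ E i := by
  intro E hE hEf
  obtain ⟨δ, hmem, hdeg, hi, hf, -⟩ := exists_parent_of_mem_support_step_translate_u hji hju hjf hiu hif huf p s hq β hE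
  have hδf : δ f ≤ d - 1 := by rw [hf]; exact hEf
  obtain ⟨-, h2⟩ := hled δ hmem hδf
  have h6' := h6 δ hmem
  refine ⟨?_, by rw [← hi]; exact h2⟩
  rcases Nat.eq_or_lt_of_le h6' with heq | hgt
  · have hc := hstraight δ hmem heq.symm
    have := (quad_apply hji hju hjf hiu hif huf n n 0 d).2.2.2
    rw [← hc] at this
    omega
  · omega

/-! ## 3. A translated twin-slot child in regime: weights, divisibility, σ-ledger, straightness -/

/-- **A TRANSLATED TWIN-SLOT CHILD IN REGIME IS FRAMED AGAIN, every prime, every σ = (n, n) + 0, any translation `β·e_u`**: from a twin-slot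
state (`r = n·j + n·i ∣ F`, order `p + n`, `n + d = p`, `2 ≤ d`) straight in support form and with the σ-ledger, the child
`step p univ j (update 0 u β) s` — if of order `p + n` and `e_G = 3` — has the same weights, `x^r ∣`, the σ-ledger (§2), a straight residual
cone `a′·x_f^d` (`a′ ≠ 0`, §1), and the support dress «degree `p + n` ⇒ the cone». [OURS] [cite: CossartJannsenSaito2020, Thm. 3.14]
[cite: Hauser2010, §§F–G] -/
theorem translated_child_frame_sigma (p : ℕ) [Fact p.Prime] [CharP K p] [DecidableEq K] {n d : ℕ} (hσ : n + d = p) (hn : 0 < n)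
    (hd2 : 2 ≤ d) {s : State K} (hr : s.r = Finsupp.single j n + Finsupp.single i n) (hdiv : ∀ e ∈ s.F.support, s.r ≤ e)
    (ho : ordZero s.F = ((p + n : ℕ) : ℕ∞))
    (hstraight : ∀ e ∈ s.F.support, e.degree = p + n →
      e = Finsupp.single j n + Finsupp.single i n + Finsupp.single u 0 + Finsupp.single f d)
    (hled : ∀ e ∈ s.F.support, e f ≤ d - 1 → n + 1 ≤ e j ∧ n + 1 ≤ e i) (β : K)
    (ho' : ordZero (CentreBlowup.step p Finset.univ j (Function.update (0 : Fin 4 → K) u β) s).F = ((p + n : ℕ) : ℕ∞))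
    (he3' : Module.finrank K (resVertex (CentreBlowup.step p Finset.univ j (Function.update (0 : Fin 4 → K) u β) s)) = 3) :
    (CentreBlowup.step p Finset.univ j (Function.update (0 : Fin 4 → K) u β) s).r = Finsupp.single j n + Finsupp.single i n ∧
      (∀ e ∈ (CentreBlowup.step p Finset.univ j (Function.update (0 : Fin 4 → K) u β) s).F.support,
        (CentreBlowup.step p Finset.univ j (Function.update (0 : Fin 4 → K) u β) s).r ≤ e) ∧
      (∀ e ∈ (CentreBlowup.step p Finset.univ j (Function.update (0 : Fin 4 → K) u β) s).F.support,
        e f ≤ d - 1 → n + 1 ≤ e j ∧ n + 1 ≤ e i) ∧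
      (∃ a : K, a ≠ 0 ∧ resForm (CentreBlowup.step p Finset.univ j (Function.update (0 : Fin 4 → K) u β) s) = C a * X f ^ d) ∧
      (∀ e ∈ (CentreBlowup.step p Finset.univ j (Function.update (0 : Fin 4 → K) u β) s).F.support, e.degree = p + n →
        e = Finsupp.single j n + Finsupp.single i n + Finsupp.single u 0 + Finsupp.single f d) := by
  classical
  set s' := CentreBlowup.step p Finset.univ j (Function.update (0 : Fin 4 → K) u β) s with hs'
  have hrj : s.r j = n := by rw [hr]; simp [hji]
  have hrdeg : s.r.degree = 2 * n := by rw [hr, map_add, Finsupp.degree_single, Finsupp.degree_single]; ring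
  have hq : ((p : ℕ) : ℕ∞) ≤ ordAlong Finset.univ s.F := by
    rw [ordAlong_univ, ho]; exact_mod_cast (by omega : p ≤ p + n)
  have h6 : ∀ e ∈ s.F.support, p + n ≤ e.degree := fun e he => le_degree_of_mem_support_of_ordZero ho he
  -- weights
  have hbj : Function.update (0 : Fin 4 → K) u β j = 0 := by rw [Function.update_of_ne hju]; rfl
  have hr' : s'.r = Finsupp.single j n + Finsupp.single i n := by
    ext k
    rw [hs', SwapTransport.step_r_apply_gen p ho j _ k]
    by_cases hkj : k = j
    · rw [if_pos hkj, hkj, Finsupp.add_apply, Finsupp.single_eq_same, Finsupp.single_eq_of_ne hji]; omega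
    · rw [if_neg hkj]
      by_cases hku : k = u
      · subst hku
        rw [hr, Finsupp.add_apply, Finsupp.single_eq_of_ne hju.symm, Finsupp.single_eq_of_ne hiu.symm, add_zero]
        split_ifs <;> rfl
      · rw [if_pos (by rw [Function.update_of_ne hku]; rfl), hr]
  have hdiv' : ∀ e ∈ s'.F.support, s'.r ≤ e := SwapTransport.forall_le_step_gen (q := p) s hdiv j hbj
  -- the σ-ledger of the child (§2)
  have hled' := ledger_step_translate_u_sigma hji hju hjf hiu hif huf p hσ s hq h6 hstraight hled (by omega) β
  -- straightness from `e_G = 3` and the ledger (§1)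
  obtain ⟨a, ha, hform'⟩ := straight_of_finrank_three_of_ledger_sigma hji hjf hif p hσ hn (by omega) hr' hdiv' ho' he3' hled'
  refine ⟨hr', hdiv', hled', ⟨a, ha, hform'⟩, fun e he hdeg => ?_⟩
  -- support dress of straightness
  have hrdeg' : s'.r.degree + d = p + n := by rw [hr', map_add, Finsupp.degree_single, Finsupp.degree_single]; omega
  obtain ⟨-, hst⟩ := SwapTransport.readings_of_resForm_sigma ho' hrdeg' hform'
  obtain ⟨m, rfl⟩ : ∃ m, e = s'.r + m := ⟨e - s'.r, (add_tsub_cancel_of_le (hdiv' e he)).symm⟩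
  have hm : m.degree = d := by rw [map_add] at hdeg; omega
  by_cases hmf : m = Finsupp.single f d
  · rw [hmf, hr', Finsupp.single_zero, add_zero]
  · exact absurd (hst m hm hmf) (mem_support_iff.mp he)

end Letters

end ResCone

end Summit.ResolutionOfSingularities.ResolutionOfSingularities.Theorems.PIDim4

end
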